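import Mathlib
import HarnessLib

/-!
# PneNP / OverlapGapAlgebra — `SearchHardWindow`: occurrence-local rung, high-degree statistics

Support for crux `stmt-PneNP-2460` (`Summit.PneNP.PneNP.Theses.OverlapGapAlgebra.SearchHardWindow`),
sixth file of the OCCURRENCE-LOCAL RUNG (prefix `shwL_`). Elementary counting over the uniform
variable pattern `V : Fin m × Fin k → Fin n` (all `k m` slots i.i.d. uniform), used by
`…LocalRungAdvice` to discard the clauses touching a variable of degree `> D`:

* `shwL_card_agreeOn_mul_le` — prescribing that `#T` other slots carry the variable of slot `a`
  costs a factor `n^{#T}` (injection `(V, w) ↦ V[T ↦ w]`);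
* `shwL_card_highSlot_mul_le` — the patterns in which the variable of a fixed slot has degree
  `> D` are at most a `C(mk - 1, D)/n^D` fraction;
* `shwL_card_manyHighClauses_mul_le` — Markov: the patterns with `≥ hh` clauses touching a
  variable of degree `> D` are at most a `m k · C(mk - 1, D)/(hh · n^D)` fraction.

No definitions; axioms `propext`, `Classical.choice`, `Quot.sound`.
-/

set_option linter.dupNamespace false -- `Summit.PneNP.PneNP.…`: summit = sub-problem (D-0017)

namespace Summit.PneNP.PneNP.Theorems

open Finset

section HighSlots

variable {σ : Type*} [Fintype σ] [DecidableEq σ] {n : ℕ}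

/-- **`D` prescribed coincidences cost a factor `n^D`.** For a slot `a` and a set `T` of other
slots, the variable patterns that agree with `V a` on all of `T` satisfy
`#{V : ∀ b ∈ T, V b = V a} · n^{#T} ≤ #patterns` (the map `(V, w) ↦ V[T ↦ w]` is injective on
them). -/
theorem shwL_card_agreeOn_mul_le (a : σ) (T : Finset σ) (haT : a ∉ T) :
    (univ.filter fun V : σ → Fin n => ∀ b ∈ T, V b = V a).card * n ^ T.card
      ≤ Fintype.card (σ → Fin n) := by
  have h := card_le_card_of_injOn
    (s := (univ.filter fun V : σ → Fin n => ∀ b ∈ T, V b = V a) ×ˢ (univ : Finset (T → Fin n)))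
    (t := (univ : Finset (σ → Fin n)))
    (fun p b => if hb : b ∈ T then p.2 ⟨b, hb⟩ else p.1 b) (fun p _ => mem_coe.2 (mem_univ _)) ?_
  · rwa [card_product, card_univ, Fintype.card_fun, Fintype.card_coe, Fintype.card_fin,
      card_univ] at h
  · rintro ⟨V, w⟩ hp ⟨V', w'⟩ hp' hEq
    simp only [coe_product, coe_filter, coe_univ, Set.mem_prod, Set.mem_setOf_eq, mem_univ,
      true_and, Set.mem_univ, and_true] at hp hp'
    have hw : w = w' := by
      funext ⟨b, hb⟩
      have := congr_fun hEq b
      simpa [hb] using this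
    have hoff : ∀ b, b ∉ T → V b = V' b := by
      intro b hb
      have := congr_fun hEq b
      simpa [hb] using this
    have hVa : V a = V' a := hoff a haT
    refine Prod.ext (funext fun b => ?_) hw
    show V b = V' b
    by_cases hb : b ∈ T
    · rw [hp b hb, hp' b hb, hVa]
    · exact hoff b hb

/-- **A slot of high degree forces `D` coincidences.** The variable patterns in which the variable
of slot `a` occurs in more than `D` slots number at most `C(#σ - 1, D) · #patterns / n^D`. -/
theorem shwL_card_highSlot_mul_le (a : σ) (D : ℕ) :
    (univ.filter fun V : σ → Fin n => D < (univ.filter fun b : σ => V b = V a).card).card * n ^ D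
      ≤ (Fintype.card σ - 1).choose D * Fintype.card (σ → Fin n) := by
  have hsub : (univ.filter fun V : σ → Fin n => D < (univ.filter fun b : σ => V b = V a).card)
      ⊆ ((univ.erase a).powersetCard D).biUnion fun T =>
          univ.filter fun V : σ → Fin n => ∀ b ∈ T, V b = V a := by
    intro V hV
    simp only [mem_filter, mem_univ, true_and] at hV
    have hD : D ≤ ((univ.filter fun b : σ => V b = V a).erase a).card := by
      have : a ∈ univ.filter fun b : σ => V b = V a := by simp
      rw [card_erase_of_mem this]; omega
    obtain ⟨T, hTsub, hTcard⟩ := exists_subset_card_eq hD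
    simp only [mem_biUnion, mem_powersetCard, mem_filter, mem_univ, true_and]
    refine ⟨T, ⟨fun b hb => ?_, hTcard⟩, fun b hb => ?_⟩
    · have := hTsub hb
      rw [mem_erase] at this
      exact mem_erase.2 ⟨this.1, mem_univ _⟩
    · have := hTsub hb
      rw [mem_erase, mem_filter] at this
      exact this.2.2
  calc (univ.filter fun V : σ → Fin n => D < (univ.filter fun b : σ => V b = V a).card).card * n ^ D
      ≤ (∑ T ∈ (univ.erase a).powersetCard D,
          (univ.filter fun V : σ → Fin n => ∀ b ∈ T, V b = V a).card) * n ^ D :=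
        Nat.mul_le_mul_right _ ((card_le_card hsub).trans card_biUnion_le)
    _ = ∑ T ∈ (univ.erase a).powersetCard D,
          (univ.filter fun V : σ → Fin n => ∀ b ∈ T, V b = V a).card * n ^ D := sum_mul _ _ _
    _ ≤ ∑ _T ∈ (univ.erase a).powersetCard D, Fintype.card (σ → Fin n) := by
        refine sum_le_sum fun T hT => ?_
        rw [mem_powersetCard] at hT
        have haT : a ∉ T := fun h => by simpa using hT.1 h
        rw [← hT.2]
        exact shwL_card_agreeOn_mul_le a T haT
    _ = (Fintype.card σ - 1).choose D * Fintype.card (σ → Fin n) := by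
        rw [sum_const, card_powersetCard, card_erase_of_mem (mem_univ a), card_univ, smul_eq_mul]

end HighSlots

section HighClauses

/-- **Few clauses touch a high-degree variable (Markov).** The variable patterns of `F_k(n, m)` in
which at least `hh` clauses contain a variable occurring in more than `D` slots satisfy
`#{V : hh ≤ #such clauses} · hh · n^D ≤ m k · C(mk - 1, D) · #patterns`. -/
theorem shwL_card_manyHighClauses_mul_le {m k n : ℕ} (D hh : ℕ) :
    (univ.filter fun V : Fin m × Fin k → Fin n => hh ≤ (univ.filter fun i : Fin m => ∃ j : Fin k,
        D < (univ.filter fun a : Fin m × Fin k => V a = V (i, j)).card).card).card * hh * n ^ D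
      ≤ m * k * (m * k - 1).choose D * Fintype.card (Fin m × Fin k → Fin n) := by
  set Hc : (Fin m × Fin k → Fin n) → ℕ := fun V => (univ.filter fun i : Fin m => ∃ j : Fin k,
    D < (univ.filter fun a : Fin m × Fin k => V a = V (i, j)).card).card with hHc
  -- Markov
  have hmarkov : (univ.filter fun V : Fin m × Fin k → Fin n => hh ≤ Hc V).card * hh
      ≤ ∑ V : Fin m × Fin k → Fin n, Hc V := by
    calc (univ.filter fun V : Fin m × Fin k → Fin n => hh ≤ Hc V).card * hh
        = (univ.filter fun V : Fin m × Fin k → Fin n => hh ≤ Hc V).card • hh := (smul_eq_mul _ _).symm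
      _ ≤ ∑ V ∈ univ.filter (fun V : Fin m × Fin k → Fin n => hh ≤ Hc V), Hc V :=
          card_nsmul_le_sum _ _ _ fun V hV => (mem_filter.1 hV).2
      _ ≤ ∑ V : Fin m × Fin k → Fin n, Hc V :=
          sum_le_sum_of_subset_of_nonneg (filter_subset _ _) fun _ _ _ => Nat.zero_le _
  -- a high clause has a high slot
  have hHle : ∀ V : Fin m × Fin k → Fin n, Hc V ≤ ∑ a : Fin m × Fin k,
      (if D < (univ.filter fun b : Fin m × Fin k => V b = V a).card then 1 else 0) := by
    intro V
    have hsub : (univ.filter fun i : Fin m => ∃ j : Fin k,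
        D < (univ.filter fun a : Fin m × Fin k => V a = V (i, j)).card)
          ⊆ (univ.filter fun a : Fin m × Fin k =>
              D < (univ.filter fun b : Fin m × Fin k => V b = V a).card).image Prod.fst := by
      intro i hi
      simp only [mem_filter, mem_univ, true_and] at hi
      obtain ⟨j, hj⟩ := hi
      exact mem_image.2 ⟨(i, j), mem_filter.2 ⟨mem_univ _, hj⟩, rfl⟩
    calc Hc V ≤ ((univ.filter fun a : Fin m × Fin k =>
          D < (univ.filter fun b : Fin m × Fin k => V b = V a).card).image Prod.fst).card :=
          card_le_card hsub
      _ ≤ (univ.filter fun a : Fin m × Fin k =>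
          D < (univ.filter fun b : Fin m × Fin k => V b = V a).card).card := card_image_le
      _ = ∑ a : Fin m × Fin k,
          (if D < (univ.filter fun b : Fin m × Fin k => V b = V a).card then 1 else 0) := by
          rw [sum_boole, Nat.cast_id]
  calc (univ.filter fun V : Fin m × Fin k → Fin n => hh ≤ Hc V).card * hh * n ^ D
      ≤ (∑ V : Fin m × Fin k → Fin n, Hc V) * n ^ D := Nat.mul_le_mul_right _ hmarkov
    _ ≤ (∑ V : Fin m × Fin k → Fin n, ∑ a : Fin m × Fin k,
          (if D < (univ.filter fun b : Fin m × Fin k => V b = V a).card then 1 else 0)) * n ^ D :=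
        Nat.mul_le_mul_right _ (sum_le_sum fun V _ => hHle V)
    _ = ∑ a : Fin m × Fin k, (univ.filter fun V : Fin m × Fin k → Fin n =>
          D < (univ.filter fun b : Fin m × Fin k => V b = V a).card).card * n ^ D := by
        rw [sum_comm, sum_mul]
        refine sum_congr rfl fun a _ => ?_
        rw [sum_boole, Nat.cast_id]
    _ ≤ ∑ _a : Fin m × Fin k, (m * k - 1).choose D * Fintype.card (Fin m × Fin k → Fin n) := by
        refine sum_le_sum fun a _ => ?_
        have := shwL_card_highSlot_mul_le (n := n) a D
        rwa [Fintype.card_prod, Fintype.card_fin, Fintype.card_fin] at this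
    _ = m * k * (m * k - 1).choose D * Fintype.card (Fin m × Fin k → Fin n) := by
        rw [sum_const, card_univ, Fintype.card_prod, Fintype.card_fin, Fintype.card_fin, smul_eq_mul]
        ring

end HighClauses

end Summit.PneNP.PneNP.Theorems
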